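import Summits.BirchSwinnertonDyer.Rank1Residual.X1.GeneratorBoundFitting
import Summits.BirchSwinnertonDyer.Rank1Residual.X1.LayerAlgebra
import HarnessLib

/-!
# `𝔪^B` of `Λ = ℤ_p⟦T⟧` coefficientwise, cancellation of `p^a`, and the route-M KILL step
# `pⁿμ + ord_𝔪 N_n(D) ≥ B`

B2B cell `bsd-rank1-residual`, unit `eisenstein-p1` GEN 18, FILE 17 (X1R0-GAPMAP §21.1, §27).
HONEST FRAMING: research route; THEOREMS ONLY (no `def`, no named fact); pure commutative algebra
of `Λ = ℤ_p⟦T⟧`; nothing about any curve; nothing booked.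

LEMMA M (FILE 11 at layer `0`, FILE 15 at layer `n`) concludes `char X ⊆ 𝔪^B`, resp.
`N_n(f) ∈ 𝔪^B` for a characteristic power series `f`; FILE 10 §4 reads `f ∈ 𝔪^B` as
`p^{B−i} ∣ f_i` for all `i`. The census's CLOSURE step is the contrapositive applied to a
factorisation `f = p^μ · D · u` (`u` a unit, `D` a candidate divisor of the `p`-adic
`L`-function): it needs the CONVERSE reading and the CANCELLATION of `p^μ`. This file supplies them:

* §1 **`mem_maximalIdeal_pow_iff`: `f ∈ 𝔪^B ↔ ∀ i, p^{B−i} ∣ f_i`** (`𝔪 = (p, T)`; so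
  `ord_𝔪 f = min_i (v_p(f_i) + i)` and `𝔪^B = {ord_𝔪 ≥ B}`);
* §2 **`C_pow_mul_mem_maximalIdeal_pow_iff`: `p^a · g ∈ 𝔪^B ↔ g ∈ 𝔪^{B−a}`** (truncated
  subtraction; `ord_𝔪(p^a g) = a + ord_𝔪 g`), `mul_mem_maximalIdeal_pow_iff_of_isUnit`;
* §3 the KILL STEP of route M at layer `n`: **`layerNorm_mem_maximalIdeal_pow_of_eq_mul`:
  `N_n(f) ∈ 𝔪^B`, `f = p^μ·D·u`, `u` a unit ⇒ `N_n(D) ∈ 𝔪^{B − μpⁿ}`** (FILE 13: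
  `N_n(p^μ) = p^{μpⁿ}`, `N_n` multiplicative, `N_n(u)` a unit), with the coefficient / valuation
  readings `p^{B − μpⁿ − i} ∣ N_n(D)_i`, **`B ≤ μpⁿ + v_p(N_n(D)_i) + i`** — the census rule
  "`pⁿμ + mord_n(D) ≥ B_n`" (at `p = 3`, `n = 1`: "`3μ + mord₁(D) ≥ B₁`"); and the layer-`0`
  form `mem_maximalIdeal_pow_of_eq_mul` (`f ∈ 𝔪^B ⇒ D ∈ 𝔪^{B−μ}`).

## Sources
* R. Greenberg, LNM 1716 (1999), p. 137 (the generator count). [GreenbergLNM1716]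
* L. Washington, GTM 83, §13.2; §7.1 (`𝔪 = (p, T)`). [Washington1997]
-/

noncomputable section

namespace Summit.BirchSwinnertonDyer.Rank1Residual.X1.MaximalIdealPowCoeff

open PowerSeries IsLocalRing Literature.NumberTheory.EllipticCurves
  Summit.BirchSwinnertonDyer.Rank1Residual.X1.LayerAlgebra

variable {p : ℕ} [hp : Fact p.Prime]

/-! ## §1. `𝔪^B` coefficientwise -/

/-- `T ∈ 𝔪_Λ`. [folklore] -/
theorem X_mem_maximalIdeal : (X : IwasawaAlgebra p) ∈ maximalIdeal (IwasawaAlgebra p) := by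
  rw [mem_maximalIdeal, mem_nonunits_iff]
  intro hu
  have h := hu.map (constantCoeff (R := ℤ_[p]))
  rw [constantCoeff_X] at h
  exact not_isUnit_zero h

/-- `p^k · c ∈ 𝔪^k`. [folklore] -/
theorem C_p_pow_mul_mem_maximalIdeal_pow (k : ℕ) (c : IwasawaAlgebra p) :
    C ((p : ℤ_[p]) ^ k) * c ∈ maximalIdeal (IwasawaAlgebra p) ^ k := by
  rw [map_pow]
  exact Ideal.mul_mem_right _ _ (Ideal.pow_mem_pow (IwasawaAlgebra.C_p_mem_maximalIdeal p) k)

/-- **`(∀ i, p^{B−i} ∣ f_i) ⇒ f ∈ 𝔪^B`** (converse of FILE 10's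
`pow_dvd_coeff_of_mem_maximalIdeal_pow`): `f = f(0) + T·(shift f)` with `p^B ∣ f(0)` and, by
induction, `shift f ∈ 𝔪^{B−1}`. [folklore] -/
theorem mem_maximalIdeal_pow_of_forall_pow_dvd_coeff :
    ∀ (B : ℕ) (f : IwasawaAlgebra p), (∀ i : ℕ, (p : ℤ_[p]) ^ (B - i) ∣ coeff i f) →
      f ∈ maximalIdeal (IwasawaAlgebra p) ^ B := by
  intro B
  induction B with
  | zero => intro f _; rw [pow_zero, Ideal.one_eq_top]; exact Submodule.mem_top
  | succ B ih =>
    intro f hf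
    rw [eq_X_mul_shift_add_const f]
    refine Ideal.add_mem _ ?_ ?_
    · rw [pow_succ']
      refine Ideal.mul_mem_mul X_mem_maximalIdeal (ih _ fun i => ?_)
      rw [coeff_mk]
      have h := hf (i + 1)
      rwa [Nat.succ_sub_succ] at h
    · obtain ⟨c, hc⟩ := hf 0
      rw [Nat.sub_zero, coeff_zero_eq_constantCoeff] at hc
      rw [hc, map_mul]
      exact C_p_pow_mul_mem_maximalIdeal_pow (B + 1) _

/-- **`f ∈ 𝔪^B ↔ ∀ i, p^{B−i} ∣ f_i`**, i.e. `𝔪^B = {f : ord_𝔪 f ≥ B}` with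
`ord_𝔪 f = min_i (v_p(f_i) + i)`. [folklore] -/
theorem mem_maximalIdeal_pow_iff {B : ℕ} {f : IwasawaAlgebra p} :
    f ∈ maximalIdeal (IwasawaAlgebra p) ^ B ↔ ∀ i : ℕ, (p : ℤ_[p]) ^ (B - i) ∣ coeff i f :=
  ⟨GeneratorBoundFitting.pow_dvd_coeff_of_mem_maximalIdeal_pow,
    mem_maximalIdeal_pow_of_forall_pow_dvd_coeff B f⟩

/-! ## §2. Cancellation of `p^a` and of units -/

/-- `p^m ∣ p^a x ↔ p^{m−a} ∣ x` in `ℤ_p` (truncated subtraction). [folklore] -/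
theorem pow_dvd_pow_mul_iff {m a : ℕ} {x : ℤ_[p]} :
    (p : ℤ_[p]) ^ m ∣ (p : ℤ_[p]) ^ a * x ↔ (p : ℤ_[p]) ^ (m - a) ∣ x := by
  have hp0 : (p : ℤ_[p]) ^ a ≠ 0 := pow_ne_zero _ (NeZero.ne _)
  rcases le_or_gt m a with hma | ham
  · rw [Nat.sub_eq_zero_of_le hma, pow_zero]
    exact ⟨fun _ => one_dvd _, fun _ => (pow_dvd_pow _ hma).mul_right _⟩
  · obtain ⟨k, rfl⟩ := Nat.exists_eq_add_of_lt ham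
    rw [show a + k + 1 - a = k + 1 by omega,
      show (p : ℤ_[p]) ^ (a + k + 1) = (p : ℤ_[p]) ^ a * (p : ℤ_[p]) ^ (k + 1) by ring,
      mul_dvd_mul_iff_left hp0]

/-- **`p^a · g ∈ 𝔪^B ↔ g ∈ 𝔪^{B−a}`** (truncated subtraction: for `a ≥ B` both sides hold):
`ord_𝔪(p^a g) = a + ord_𝔪 g`. [folklore] -/
theorem C_pow_mul_mem_maximalIdeal_pow_iff {B a : ℕ} {g : IwasawaAlgebra p} :
    C ((p : ℤ_[p]) ^ a) * g ∈ maximalIdeal (IwasawaAlgebra p) ^ B ↔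
      g ∈ maximalIdeal (IwasawaAlgebra p) ^ (B - a) := by
  rw [mem_maximalIdeal_pow_iff, mem_maximalIdeal_pow_iff]
  refine forall_congr' fun i => ?_
  rw [coeff_C_mul, pow_dvd_pow_mul_iff, Nat.sub_right_comm]

/-- `f · u ∈ 𝔪^B ↔ f ∈ 𝔪^B` for a unit `u`. [folklore] -/
theorem mul_mem_maximalIdeal_pow_iff_of_isUnit {B : ℕ} {f u : IwasawaAlgebra p} (hu : IsUnit u) :
    f * u ∈ maximalIdeal (IwasawaAlgebra p) ^ B ↔ f ∈ maximalIdeal (IwasawaAlgebra p) ^ B :=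
  Ideal.mul_unit_mem_iff_mem _ hu

/-- **Layer-`0` kill step:** `f ∈ 𝔪^B`, `f = p^μ · D · u`, `u` a unit ⇒ `D ∈ 𝔪^{B−μ}`, i.e.
`μ + ord_𝔪 D ≥ B`. [cite: GreenbergLNM1716, p. 137] -/
theorem mem_maximalIdeal_pow_of_eq_mul {B μ : ℕ} {f D u : IwasawaAlgebra p}
    (hf : f ∈ maximalIdeal (IwasawaAlgebra p) ^ B) (hfac : f = C ((p : ℤ_[p]) ^ μ) * D * u)
    (hu : IsUnit u) : D ∈ maximalIdeal (IwasawaAlgebra p) ^ (B - μ) := by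
  rw [hfac, mul_mem_maximalIdeal_pow_iff_of_isUnit hu, C_pow_mul_mem_maximalIdeal_pow_iff] at hf
  exact hf

/-! ## §3. The kill step at layer `n`: `pⁿμ + ord_𝔪 N_n(D) ≥ B` -/

section Layer

variable (n : ℕ)

/-- **Route M's kill step at layer `n`:** if `N_n(f) ∈ 𝔪^B` (LEMMA M at layer `n`) and
`f = p^μ · D · u` with `u` a unit, then `N_n(D) ∈ 𝔪^{B − μpⁿ}` (`N_n(p^μ) = p^{μpⁿ}`, `N_n(u)`
a unit). [cite: GreenbergLNM1716, p. 137] [cite: Washington1997, §13.2] -/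
theorem layerNorm_mem_maximalIdeal_pow_of_eq_mul {B μ : ℕ} {f D u : IwasawaAlgebra p}
    (hN : layerNorm p n f ∈ maximalIdeal (IwasawaAlgebra p) ^ B)
    (hfac : f = C ((p : ℤ_[p]) ^ μ) * D * u) (hu : IsUnit u) :
    layerNorm p n D ∈ maximalIdeal (IwasawaAlgebra p) ^ (B - μ * p ^ n) := by
  rw [hfac, map_mul, map_mul, layerNorm_C, ← pow_mul,
    mul_mem_maximalIdeal_pow_iff_of_isUnit (hu.map _), C_pow_mul_mem_maximalIdeal_pow_iff] at hN
  exact hN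

/-- Coefficient form: `p^{B − μpⁿ − i} ∣ N_n(D)_i` for every `i`. [cite: GreenbergLNM1716, p. 137] -/
theorem pow_dvd_coeff_layerNorm_of_eq_mul {B μ : ℕ} {f D u : IwasawaAlgebra p}
    (hN : layerNorm p n f ∈ maximalIdeal (IwasawaAlgebra p) ^ B)
    (hfac : f = C ((p : ℤ_[p]) ^ μ) * D * u) (hu : IsUnit u) (i : ℕ) :
    (p : ℤ_[p]) ^ (B - μ * p ^ n - i) ∣ coeff i (layerNorm p n D) :=
  GeneratorBoundFitting.pow_dvd_coeff_of_mem_maximalIdeal_pow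
    (layerNorm_mem_maximalIdeal_pow_of_eq_mul n hN hfac hu) i

/-- **The census rule `pⁿμ + mord_n(D) ≥ B_n`:** `B ≤ μpⁿ + v_p(N_n(D)_i) + i` for every non-zero
coefficient `N_n(D)_i` (so a candidate divisor `D` with `μpⁿ + min_i(v_p(N_n(D)_i) + i) < B` is
NOT `char X` up to `p^μ` and a unit). [cite: GreenbergLNM1716, p. 137] -/
theorem le_mu_mul_add_valuation_coeff_layerNorm_add {B μ : ℕ} {f D u : IwasawaAlgebra p}
    (hN : layerNorm p n f ∈ maximalIdeal (IwasawaAlgebra p) ^ B)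
    (hfac : f = C ((p : ℤ_[p]) ^ μ) * D * u) (hu : IsUnit u) {i : ℕ}
    (hi : coeff i (layerNorm p n D) ≠ 0) :
    B ≤ μ * p ^ n + ((coeff i (layerNorm p n D)).valuation + i) := by
  have h := GeneratorBoundFitting.le_valuation_coeff_add_of_mem_maximalIdeal_pow
    (layerNorm_mem_maximalIdeal_pow_of_eq_mul n hN hfac hu) i hi
  omega

end Layer

end Summit.BirchSwinnertonDyer.Rank1Residual.X1.MaximalIdealPowCoeff

end
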